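import Summits.ResolutionOfSingularities.ResolutionOfSingularities.Theorems.MarkedTransferCampaignW31RegularCut
import Summits.ResolutionOfSingularities.ResolutionOfSingularities.Theorems.MarkedTransferCampaignW31UscAssembly
import Literature.AlgebraicGeometry.Hironaka2017.Lib.CoreFocusCandidates
import HarnessLib

/-!
# [OURS · L1 W3.1] The weaker door ⟨OrdPowCut⟩ FEEDS the cut-down: existence of `Ě` (`S06BaseHike.U30_2_R2_inst`)
# from the closedness half of slot W3.1 and «ordinary = order-defined powers along `Σ̄_max`» — no regularity of `Σ̄_max`

Cell `res-hironaka`, rung L (rescue), slot W3.1 aftercare (OURS typer o4; companion of p476257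
`Theorems/MarkedTransferCampaignW31RegularCut.lean`). That statement-only file typed, BY NAME, the property
`CampaignW31.OrdPowAlong C` («every ideal sheaf of order `≥ μ` along `C` lies in `𝓘_C^μ`») and the door
`CampaignW31.OrdPowCutOn` / `CampaignW31.HatOrdPowCut` in the binder shape of res-adj-3's R12/12a premise
`S06BaseHike.RegularCut_ours` (res-type-010, R010e p472988), recording res-type-010's NOTE 2026-08-26T21:13:46Z (1) that the
cut-down witness `S06BaseHike.cutDown Ê C = (J ⊔ 𝓘_C^d, d)` of `Lib/CoreFocusCutDown.lean` (p470790) consumes «`C` regular» ONLY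
through that property (tree lemma `le_vanishingIdeal_pow_of_forall_le_idealOrder`, [CoP1] Prop. 4.2). This file makes the
record kernel-checked:

* `CampaignW31.pAlg_le_cutDown_of_ordPowAlong`, `isCoreFocus_cutDown_of_ordPowAlong` (+ `_of_excellent`, `_ambient`,
  `isCoreFocus_cutDown_invmaxClosure[_ambient]`, `exists_isCoreFocus_of_ordPowCutOn[_ambient]`): res-type-010's
  `pAlg_le_cutDown` / `isCoreFocus_cutDown` with «`C` regular» REPLACED by `OrdPowAlong C` — same proof, one line changed
  (regularity of `Z` is then needed only for «`Sing` closed»); canonical witness `cutDown Ê Σ̄_max = (J ⊔ 𝓘_{Σ̄_max}^d, d)`;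
* `CampaignW31.U30_2_R2_inst_of_hatOrdPowCut`: `HatOrdPowCut IsEdgeData A n → U30_2_R2_inst IsEdgeData A n` — the ORD-POW
  analogue of `S06BaseHike.U30_2_R2_inst_of_regularCut` (p473407): the apex modulus «existence of `Ě`» of GAP-LEDGER R12/12a
  may be cited MODULO the WEAKER premise ⟨OrdPowCut⟩ (`hatOrdPowCut_of_regularCut_ours`: ⟨RegularCut⟩ ⇒ ⟨OrdPowCut⟩);
* the NAMED RESIDUAL of the weaker door, `CampaignW31.HatClosureOrdPow` / `CampaignW31HatClosureOrdPowI p` («`OrdPowAlong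
  Σ̄_max(Ê)`» — the ORD-POW analogue of `HatClosureRegular` / `CampaignW31HatClosureRegularI p`, which imply it), with
  `hatOrdPowCut_iff` (door = closedness half ∧ residual);
* per-`p` compositions at row 005 part b's provenance, in the pattern of seat res-L1-s31-pv-2's `…W31ECheckOfUsc.lean`
  (regular door): `U30_2_R2_inst_of_invmaxClosedI_and_closureOrdPow`, `U30_2_R2_inst_of_usc_and_closureOrdPow` — existence of
  `Ě` = [W3.1 closedness (`CampaignW31InvmaxClosedI p`, resp. the slot statement `CampaignW31UscInvOneExponentI p`)] ∧
  [`CampaignW31HatClosureOrdPowI p`], per `(E, ed)` under `U30_2_R2_inst`'s own guard `0 < b̂`;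
* dictionary anchor to res-type-010's `Lib/CoreFocusCandidates.lean`: `ordPowAlong_iff_diffPower_eq_pow`
  (`OrdPowAlong C ↔ ∀ b, 𝓘_C^{⟨b⟩} = 𝓘_C^b` — the differential powers of `C` are the ordinary ones).

WHY. `OrdPowAlong Σ̄_max` holds for REGULAR `Σ̄_max` (`ordPowAlong_of_isRegular`) and is a condition on the SINGULARITIES of
`Σ̄_max` in general (informally: ordinary powers of the radical ideal without embedded components — classical, NOT used or
asserted here); the typer's UNCERTIFIED specimen of record `E_A = (z² + (y² − x³)^N, 2)` on `𝔸³` (STATUS 2026-08-26T23:59:42Z;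
cuspidal complete-intersection `Σ̄_max`, predicted `HatClosureRegular` FALSE / `OrdPowAlong` TRUE) marks cases the regular door
cannot reach. RESCUE-SEED v0.6 lists the object as the PROPOSED slot W3.6 «ORD-POW CUT» (res-plan-2 2026-08-27T00:21:24Z;
director's call); NO slot is claimed here — this is W3.1 aftercare making a typed premise consumable.

HONEST FRAMING. Everything here is OURS: theorems about OUR typed definitions (`cutDown`, `IsCoreFocus`, `U30_2_R2_inst` are
res-type-010's typings of §6.2 p.30 l.4–9 with EXISTENCE NOT SHOWN IN PRINT; `OrdPowAlong` etc. are o4's). NOTHING below is a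
statement of H. Hironaka's manuscript [Hironaka2017] and nothing of it is asserted; the manuscript stays «under review».
`HatClosureOrdPow` / `CampaignW31HatClosureOrdPowI p` are CANDIDATE premises, no argument on record either way (VACUITY: not
trivially true — predicted to fail for three concurrent lines, specimen `E_B` of the same note; not trivially false — it holds
whenever `Σ̄_max` is regular). AI bookkeeping; weaker than expert review.

## References (context; nothing below is used as a premise)
* H. Hironaka, ms. 2017-03-23, §6.2 p.30 l.4–9, Eq. (43) — scope only, under adjudication. [Hironaka2017]
* V. Cossart, O. Piltant, J. Algebra 320 (2008), Prop. 4.2 (orders along a regular centre; tree `PermissibleLSB.lean`). [CossartPiltant2008]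
* Cell records: res-type-010 `Lib/CoreFocusCutDown.lean` p470790, `Lib/CoreFocusCandidates.lean`, NOTE 2026-08-26T21:13:46Z (1);
  res-adj-3 R12/12a 21:10:17Z; o4 p476257 + NOTE 23:59:42Z; res-L1-s31-pv-2 `…ECheckOfUsc.lean`; RESCUE-SEED v0.6 §1 W3.6.
-/

noncomputable section

set_option linter.dupNamespace false -- mandated namespace of this single-conjunct summit

open _root_.AlgebraicGeometry _root_.TopologicalSpace _root_.CategoryTheory

namespace Summit.ResolutionOfSingularities.ResolutionOfSingularities.Theorems

open Literature.AlgebraicGeometry.Resolution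
open Literature.AlgebraicGeometry.Hironaka2017
open Literature.AlgebraicGeometry.Hironaka2017.S02Preliminaries
open Literature.AlgebraicGeometry.Hironaka2017.S04CharAlgebra
open Literature.AlgebraicGeometry.Hironaka2017.S06BaseHike
open Literature.AlgebraicGeometry.Hironaka2017.Datum

universe u

namespace CampaignW31

/-! ## Generic: `OrdPowAlong` versus regularity and versus res-type-010's differential powers -/

section Generic

variable {Z : Scheme.{u}} {n : ℕ}

/-- Dictionary anchor (pure order theory): `OrdPowAlong C` says exactly that every differential power `𝓘_C^{⟨b⟩}` of
res-type-010's `Lib/CoreFocusCandidates.lean` (the LARGEST ideal sheaf of order `≥ b` along `C`) is the ordinary power `𝓘_C^b`.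
[folklore] -/
theorem ordPowAlong_iff_diffPower_eq_pow (C : Closeds Z) :
    OrdPowAlong C ↔ ∀ b : ℕ, diffPower C b = Scheme.IdealSheafData.vanishingIdeal C ^ b := by
  constructor
  · intro h b
    exact le_antisymm (h fun _ hy => le_idealOrder_diffPower C b hy) (vanishingIdeal_pow_le_diffPower C b)
  · intro h J μ hJ
    exact (le_diffPower hJ).trans (h μ).le

/-- A REGULAR closed `C` (reduced structure) on a regular locally Noetherian scheme has `OrdPowAlong C` — the tree lemma
`le_vanishingIdeal_pow_of_forall_le_idealOrder` ([CoP1] Prop. 4.2, orders along a regular centre), read through the typed name.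
[cite: CossartPiltant2008, Prop. 4.2 (proof)] -/
theorem ordPowAlong_of_isRegular [IsLocallyNoetherian Z] (hZ : Scheme.IsRegular Z) {C : Closeds Z}
    (hC : Scheme.IsRegular (Scheme.IdealSheafData.vanishingIdeal C).subscheme) : OrdPowAlong C :=
  fun _ _ hJ => le_vanishingIdeal_pow_of_forall_le_idealOrder hZ hC hJ

/-- ⟨RegularCut⟩ ⇒ ⟨OrdPowCut⟩ for `(S, f)` on a regular locally Noetherian scheme: the weaker door IS weaker. [folklore] -/
theorem ordPowCutOn_of_regularCutOn [IsLocallyNoetherian Z] (hZ : Scheme.IsRegular Z) {S : Set Z} {f : Z → EdgeInv n}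
    (h : RegularCutOn S f) : OrdPowCutOn S f := by
  obtain ⟨C, hreg, hC, hCcl⟩ := h
  exact ⟨C, ordPowAlong_of_isRegular hZ hreg, hC, hCcl⟩

/-! ## The cut-down by a closed set with `OrdPowAlong` is a core focusing (res-type-010's argument, hypothesis weakened) -/

/-- **Every exponent whose singular locus contains `C` lies under the cut-down in ℘, for `C` with `OrdPowAlong C`** (any
locally Noetherian `Z`; no regularity of `Z` or `C`): `J_F ⊆ 𝓘_C^{b_F}` is now the HYPOTHESIS `OrdPowAlong C` applied to
`C ⊆ Sing(F)`, then `𝔖(F) ⊇ 𝔖((𝓘_C^{b_F}, b_F)) = 𝔖((𝓘_C, 1)) = 𝔖((𝓘_C^d, d)) ⊇ 𝔖(cutDown Ê C)` by [F1] and monotonicity;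
`F.b = 0` lies under everything. Adapted from `Lib/CoreFocusCutDown.pAlg_le_cutDown` (res-type-010, p470790) — the same proof
with `hCreg` replaced by what it was used for. NOT a statement of the manuscript. [folklore] -/
theorem pAlg_le_cutDown_of_ordPowAlong [IsLocallyNoetherian Z] (Ehat : IdealExponent Z) (hd : 0 < Ehat.b)
    (C : Closeds Z) (hCop : OrdPowAlong C) (F : IdealExponent Z) (hFC : 0 < F.b → (C : Set Z) ⊆ F.sing) (a : ℕ) :
    pAlg F a ≤ pAlg (cutDown Ehat C) a := by
  -- adapted from Literature/AlgebraicGeometry/Hironaka2017/Lib/CoreFocusCutDown.lean `pAlg_le_cutDown`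
  refine pAlg_mono_of_sIncl ?_ a
  rcases Nat.eq_zero_or_pos F.b with h0 | hb
  · exact sIncl_of_b_eq_zero F _ h0
  · have hJ : F.J ≤ Scheme.IdealSheafData.vanishingIdeal C ^ F.b := hCop fun y hy => hFC hb hy
    have h1 : SIncl F ⟨Scheme.IdealSheafData.vanishingIdeal C ^ F.b, F.b⟩ :=
      sIncl_of_le (E₁ := F) (E₂ := ⟨Scheme.IdealSheafData.vanishingIdeal C ^ F.b, F.b⟩) hJ le_rfl
    have h2 : SIncl (⟨Scheme.IdealSheafData.vanishingIdeal C ^ F.b, F.b⟩ : IdealExponent Z)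
        ⟨Scheme.IdealSheafData.vanishingIdeal C, 1⟩ :=
      sIncl_pow_one _ hb
    have h3 : SIncl (⟨Scheme.IdealSheafData.vanishingIdeal C, 1⟩ : IdealExponent Z)
        ⟨Scheme.IdealSheafData.vanishingIdeal C ^ Ehat.b, Ehat.b⟩ :=
      sIncl_one_pow _ hd
    have h4 : SIncl (⟨Scheme.IdealSheafData.vanishingIdeal C ^ Ehat.b, Ehat.b⟩ : IdealExponent Z) (cutDown Ehat C) :=
      sIncl_of_le (E₁ := ⟨Scheme.IdealSheafData.vanishingIdeal C ^ Ehat.b, Ehat.b⟩) (E₂ := cutDown Ehat C)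
        le_sup_right le_rfl
    exact sIncl_trans (sIncl_trans (sIncl_trans h1 h2) h3) h4

/-- **The cut-down by a closed `C` with `OrdPowAlong C` cutting the `Inv_max`-stratum IS a core focusing** (typed
`IsCoreFocus`: (43) and ℘-maximality), on any locally Noetherian `Z`, for `0 < d`, `C ∩ Sing(Ê)_cl = Σ`, `C ⊆ closure Σ`,
and `Sing(F)` closed for every `F` with `0 < F.b` (hypothesis; discharged below on excellent regular `Z`). Adapted from
`Lib/CoreFocusCutDown.isCoreFocus_cutDown` (res-type-010) with «`C` regular» replaced by `OrdPowAlong C`. Parametric in `inv`.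
NOT a statement of the manuscript (which prints no construction of `Ě`). [folklore] -/
theorem isCoreFocus_cutDown_of_ordPowAlong [IsLocallyNoetherian Z]
    (inv : IdealExponent Z → Z → EdgeInv n) (Ehat : IdealExponent Z) (hd : 0 < Ehat.b) (C : Closeds Z)
    (hCop : OrdPowAlong C)
    (hC : (C : Set Z) ∩ (Ehat.sing ∩ S02Preliminaries.closedPoints Z) =
      invmaxStratum (Ehat.sing ∩ S02Preliminaries.closedPoints Z) (inv Ehat))
    (hCcl : (C : Set Z) ⊆ closure (invmaxStratum (Ehat.sing ∩ S02Preliminaries.closedPoints Z) (inv Ehat)))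
    (hclosed : ∀ F : IdealExponent Z, 0 < F.b → IsClosed F.sing) :
    IsCoreFocus S04CharAlgebra.pAlg inv Ehat (cutDown Ehat C) := by
  -- adapted from Literature/AlgebraicGeometry/Hironaka2017/Lib/CoreFocusCutDown.lean `isCoreFocus_cutDown`
  refine ⟨Eq43_cutDown inv Ehat C hd hC, fun F hF a => pAlg_le_cutDown_of_ordPowAlong Ehat hd C hCop F (fun hb => ?_) a⟩
  have hSF : invmaxStratum (Ehat.sing ∩ S02Preliminaries.closedPoints Z) (inv Ehat) ⊆ F.sing := by
    rw [← hF.2]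
    exact Set.inter_subset_left
  exact hCcl.trans ((hclosed F hb).closure_subset_iff.mpr hSF)

/-- `isCoreFocus_cutDown_of_ordPowAlong` on an integral Noetherian regular EXCELLENT `Z`, the closedness of `Sing` discharged
by res-type-010's `S06BaseHike.isClosed_sing` (upper semicontinuity of the order). Regularity of `Z` enters only here.
[folklore] -/
theorem isCoreFocus_cutDown_of_ordPowAlong_of_excellent [IsIntegral Z] [IsNoetherian Z] (hZ : Scheme.IsRegular Z)
    (hE : Scheme.IsExcellent Z) (inv : IdealExponent Z → Z → EdgeInv n) (Ehat : IdealExponent Z) (hd : 0 < Ehat.b)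
    (C : Closeds Z) (hCop : OrdPowAlong C)
    (hC : (C : Set Z) ∩ (Ehat.sing ∩ S02Preliminaries.closedPoints Z) =
      invmaxStratum (Ehat.sing ∩ S02Preliminaries.closedPoints Z) (inv Ehat))
    (hCcl : (C : Set Z) ⊆ closure (invmaxStratum (Ehat.sing ∩ S02Preliminaries.closedPoints Z) (inv Ehat))) :
    IsCoreFocus S04CharAlgebra.pAlg inv Ehat (cutDown Ehat C) :=
  isCoreFocus_cutDown_of_ordPowAlong inv Ehat hd C hCop hC hCcl fun F _ => isClosed_sing hZ hE F

/-- **THE CANONICAL WITNESS**: if the `Inv_max`-stratum is the trace on `Sing(Ê)_cl` of a closed set and `OrdPowAlong Σ̄_max`,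
then `cutDown Ê Σ̄_max = (J ⊔ 𝓘_{Σ̄_max}^d, d)` is a core focusing of `Ê` (integral Noetherian regular excellent `Z`, `0 < d`);
the cut is `Σ̄_max` itself (`invmaxClosure_inter_eq`). NOT a statement of the manuscript. [folklore] -/
theorem isCoreFocus_cutDown_invmaxClosure [IsIntegral Z] [IsNoetherian Z] (hZ : Scheme.IsRegular Z)
    (hE : Scheme.IsExcellent Z) (inv : IdealExponent Z → Z → EdgeInv n) (Ehat : IdealExponent Z) (hd : 0 < Ehat.b)
    (hcl : StratumRelClosedOn (Ehat.sing ∩ S02Preliminaries.closedPoints Z) (inv Ehat))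
    (hop : OrdPowAlong (invmaxClosure (Ehat.sing ∩ S02Preliminaries.closedPoints Z) (inv Ehat))) :
    IsCoreFocus S04CharAlgebra.pAlg inv Ehat
      (cutDown Ehat (invmaxClosure (Ehat.sing ∩ S02Preliminaries.closedPoints Z) (inv Ehat))) :=
  isCoreFocus_cutDown_of_ordPowAlong_of_excellent hZ hE inv Ehat hd _ hop (invmaxClosure_inter_eq hcl) subset_rfl

/-- Packaged: `⟨OrdPowCut⟩ ⇒ ∃ Ě, IsCoreFocus ℘ inv Ê Ě` (integral Noetherian regular excellent `Z`, `0 < d`). [folklore] -/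
theorem exists_isCoreFocus_of_ordPowCutOn [IsIntegral Z] [IsNoetherian Z] (hZ : Scheme.IsRegular Z)
    (hE : Scheme.IsExcellent Z) (inv : IdealExponent Z → Z → EdgeInv n) (Ehat : IdealExponent Z) (hd : 0 < Ehat.b)
    (hcut : OrdPowCutOn (Ehat.sing ∩ S02Preliminaries.closedPoints Z) (inv Ehat)) :
    ∃ Echeck : IdealExponent Z, IsCoreFocus S04CharAlgebra.pAlg inv Ehat Echeck := by
  obtain ⟨C, hCop, hC, hCcl⟩ := hcut
  exact ⟨cutDown Ehat C, isCoreFocus_cutDown_of_ordPowAlong_of_excellent hZ hE inv Ehat hd C hCop hC hCcl⟩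

end Generic

/-! ## On the manuscript's ambient datum (row 001: `Z` smooth, irreducible, of finite type over a field) -/

section Ambient

variable {p : ℕ} [Fact p.Prime] {K : Type u} [Field K] [CharP K p] {n : ℕ}

/-- The ambient scheme of a row-001 `AmbientDatum` is Noetherian (finite type over a field). [folklore] -/
private theorem ambient_isNoetherian (A : AmbientDatum p K) : IsNoetherian A.Z :=
  -- adapted from Literature/AlgebraicGeometry/Hironaka2017/Lib/CoreFocusCutDown.lean (private `isNoetherian_Z`)
  haveI := A.smooth
  haveI := A.quasiCompact
  Scheme.isNoetherian_of_finiteType_over_field A.hom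

/-- … and integral (irreducible, reduced since regular). [folklore] -/
private theorem ambient_isIntegral (A : AmbientDatum p K) : IsIntegral A.Z :=
  -- adapted from Literature/AlgebraicGeometry/Hironaka2017/Lib/CoreFocusCutDown.lean (private `isIntegral_Z`)
  haveI := A.irreducible
  haveI : IsReduced A.Z := (AmbientDatum.isRegular_Z A).isReduced
  isIntegral_of_irreducibleSpace_of_isReduced A.Z

/-- On the ambient datum every REGULAR closed `C` has `OrdPowAlong C`. [cite: CossartPiltant2008, Prop. 4.2 (proof)] -/
theorem ordPowAlong_of_isRegular_ambient (A : AmbientDatum p K) {C : Closeds A.Z}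
    (hC : Scheme.IsRegular (Scheme.IdealSheafData.vanishingIdeal C).subscheme) : OrdPowAlong C :=
  haveI := ambient_isNoetherian A
  ordPowAlong_of_isRegular (AmbientDatum.isRegular_Z A) hC

/-- On the ambient datum ⟨RegularCut⟩ ⇒ ⟨OrdPowCut⟩ for every `(S, f)`. [folklore] -/
theorem ordPowCutOn_of_regularCutOn_ambient (A : AmbientDatum p K) {S : Set A.Z} {f : A.Z → EdgeInv n}
    (h : RegularCutOn S f) : OrdPowCutOn S f :=
  haveI := ambient_isNoetherian A
  ordPowCutOn_of_regularCutOn (AmbientDatum.isRegular_Z A) h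

/-- **On the manuscript's ambient datum**: for `Ê = (J, d)` with `0 < d` and a closed `C ⊆ A.Z` with `OrdPowAlong C`,
`C ∩ Sing(Ê)_cl = Σ_max(Ê)` and `C ⊆ closure Σ_max(Ê)`, the cut-down `cutDown Ê C` is a core focusing of `Ê` in the typed
sense — OUR conditional witness for the printed existence sentence (typed `U30_2_R2`), modulo ⟨OrdPowCut⟩ only; perfectness
of `K` not used. NOT a statement of the manuscript. [folklore] -/
theorem isCoreFocus_cutDown_of_ordPowAlong_ambient (A : AmbientDatum p K)
    (inv : IdealExponent A.Z → A.Z → EdgeInv n) (Ehat : IdealExponent A.Z) (hd : 0 < Ehat.b) (C : Closeds A.Z)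
    (hCop : OrdPowAlong C)
    (hC : (C : Set A.Z) ∩ (Ehat.sing ∩ S02Preliminaries.closedPoints A.Z) =
      invmaxStratum (Ehat.sing ∩ S02Preliminaries.closedPoints A.Z) (inv Ehat))
    (hCcl : (C : Set A.Z) ⊆ closure (invmaxStratum (Ehat.sing ∩ S02Preliminaries.closedPoints A.Z) (inv Ehat))) :
    IsCoreFocus S04CharAlgebra.pAlg inv Ehat (cutDown Ehat C) :=
  haveI := ambient_isNoetherian A
  haveI := ambient_isIntegral A
  isCoreFocus_cutDown_of_ordPowAlong_of_excellent (AmbientDatum.isRegular_Z A) (AmbientDatum.isExcellent_Z A) inv Ehat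
    hd C hCop hC hCcl

/-- Packaged, ambient form: `⟨OrdPowCut⟩ ⇒ ∃ Ě, IsCoreFocus ℘ inv Ê Ě` — the conclusion of the typed `U30_2_R2` for this `Ê`,
MODULO ⟨OrdPowCut⟩. [folklore] -/
theorem exists_isCoreFocus_of_ordPowCutOn_ambient (A : AmbientDatum p K)
    (inv : IdealExponent A.Z → A.Z → EdgeInv n) (Ehat : IdealExponent A.Z) (hd : 0 < Ehat.b)
    (hcut : OrdPowCutOn (Ehat.sing ∩ S02Preliminaries.closedPoints A.Z) (inv Ehat)) :
    ∃ Echeck : IdealExponent A.Z, IsCoreFocus S04CharAlgebra.pAlg inv Ehat Echeck := by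
  obtain ⟨C, hCop, hC, hCcl⟩ := hcut
  exact ⟨cutDown Ehat C, isCoreFocus_cutDown_of_ordPowAlong_ambient A inv Ehat hd C hCop hC hCcl⟩

/-- Ambient form of the canonical witness: closedness half ∧ `OrdPowAlong Σ̄_max` ⇒ `cutDown Ê Σ̄_max` is a core focusing.
[folklore] -/
theorem isCoreFocus_cutDown_invmaxClosure_ambient (A : AmbientDatum p K)
    (inv : IdealExponent A.Z → A.Z → EdgeInv n) (Ehat : IdealExponent A.Z) (hd : 0 < Ehat.b)
    (hcl : StratumRelClosedOn (Ehat.sing ∩ S02Preliminaries.closedPoints A.Z) (inv Ehat))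
    (hop : OrdPowAlong (invmaxClosure (Ehat.sing ∩ S02Preliminaries.closedPoints A.Z) (inv Ehat))) :
    IsCoreFocus S04CharAlgebra.pAlg inv Ehat
      (cutDown Ehat (invmaxClosure (Ehat.sing ∩ S02Preliminaries.closedPoints A.Z) (inv Ehat))) :=
  isCoreFocus_cutDown_of_ordPowAlong_ambient A inv Ehat hd _ hop (invmaxClosure_inter_eq hcl) subset_rfl

end Ambient

/-! ## In the binder shape of `S06BaseHike.RegularCut_ours`: the named ORD-POW residual and `U30_2_R2_inst` -/

section Hat

variable (IsEdgeData : ∀ ⦃X : Scheme.{u}⦄ ⦃p n : ℕ⦄ (E : IdealExponent X) (ξ : X), EdgeDatumAt p n E ξ → Prop)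

/-- **[OURS · L1 W3.1] `CampaignW31.HatClosureOrdPow` — THE NAMED RESIDUAL OF THE WEAKER DOOR**: replaces the role of
NOTHING printed (no argument for the existence of `Ě`, p.30 l.4–9, is printed); NOT a statement of the manuscript. Same
binders as `S06BaseHike.RegularCut_ours IsEdgeData A n`: for every standard `E` on `A.Z` and every certified edge-data family
`ed` on `Sing(Ê)_cl` (`Ê = baseHike E`), the closure `Σ̄_max(Ê)` of the `Inv_max`-stratum of `ξ ↦ Inv_ξ(Ê)` satisfies
`OrdPowAlong` (ideal sheaves of order `≥ μ` along `Σ̄_max(Ê)` lie in the `μ`-th power of its radical ideal sheaf). The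
ORD-POW analogue of `HatClosureRegular`, which implies it (`hatClosureOrdPow_of_hatClosureRegular`); together with the
closedness half `HatStratumClosed` it is EQUIVALENT to the door `HatOrdPowCut` (`hatOrdPowCut_iff`). CANDIDATE premise: no
argument either way is on record; VACUITY: neither trivially true nor trivially false (module docstring). [folklore] -/
def HatClosureOrdPow {p : ℕ} [Fact p.Prime] {K : Type u} [Field K] [CharP K p] [PerfectField K] (A : AmbientDatum p K)
    (n : ℕ) : Prop :=
  ∀ (E : IdealExponent A.Z) (ed : EdgeDataOn p n (baseHike E)), E.IsStandard →
    IsEdgeDataOn IsEdgeData (baseHike E) ed →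
      OrdPowAlong (invmaxClosure ((baseHike E).sing ∩ S02Preliminaries.closedPoints A.Z) (invField (baseHike E) ed))

/-- Pure logic — the weaker door DECOMPOSED: `HatOrdPowCut ↔ HatStratumClosed ∧ HatClosureOrdPow`, binder for binder, by
`ordPowCutOn_iff` at each `(E, ed)`. [folklore] -/
theorem hatOrdPowCut_iff {p : ℕ} [Fact p.Prime] {K : Type u} [Field K] [CharP K p] [PerfectField K]
    (A : AmbientDatum p K) (n : ℕ) :
    HatOrdPowCut IsEdgeData A n ↔ HatStratumClosed IsEdgeData A n ∧ HatClosureOrdPow IsEdgeData A n := by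
  constructor
  · intro h
    exact ⟨fun E ed hE hed => ((ordPowCutOn_iff _ _).mp (h E ed hE hed)).1,
      fun E ed hE hed => ((ordPowCutOn_iff _ _).mp (h E ed hE hed)).2⟩
  · rintro ⟨h₁, h₂⟩ E ed hE hed
    exact (ordPowCutOn_iff _ _).mpr ⟨h₁ E ed hE hed, h₂ E ed hE hed⟩

/-- Pure logic, the direction consumers use: the two halves give the door `HatOrdPowCut`. [folklore] -/
theorem hatOrdPowCut_of_halves {p : ℕ} [Fact p.Prime] {K : Type u} [Field K] [CharP K p] [PerfectField K]
    (A : AmbientDatum p K) (n : ℕ) (h₁ : HatStratumClosed IsEdgeData A n) (h₂ : HatClosureOrdPow IsEdgeData A n) :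
    HatOrdPowCut IsEdgeData A n :=
  (hatOrdPowCut_iff IsEdgeData A n).mpr ⟨h₁, h₂⟩

/-- The regularity residual implies the ORD-POW residual (ambient datum: `Z` regular, locally Noetherian). [folklore] -/
theorem hatClosureOrdPow_of_hatClosureRegular {p : ℕ} [Fact p.Prime] {K : Type u} [Field K] [CharP K p] [PerfectField K]
    (A : AmbientDatum p K) (n : ℕ) (h : HatClosureRegular IsEdgeData A n) : HatClosureOrdPow IsEdgeData A n :=
  fun E ed hE hed => ordPowAlong_of_isRegular_ambient A (h E ed hE hed)

/-- ⟨RegularCut⟩ ⇒ ⟨OrdPowCut⟩ in res-adj-3's binder shape: `RegularCut_ours IsEdgeData A n → HatOrdPowCut IsEdgeData A n`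
(what p476257's docstring of `HatOrdPowCut` promised and did not derive). [folklore] -/
theorem hatOrdPowCut_of_regularCut_ours {p : ℕ} [Fact p.Prime] {K : Type u} [Field K] [CharP K p] [PerfectField K]
    (A : AmbientDatum p K) (n : ℕ) (h : RegularCut_ours IsEdgeData A n) : HatOrdPowCut IsEdgeData A n :=
  fun E ed hE hed => ordPowCutOn_of_regularCutOn_ambient A (h E ed hE hed)

/-- **`U30_2_R2_inst` MODULO ⟨OrdPowCut⟩** — the ORD-POW analogue of `S06BaseHike.U30_2_R2_inst_of_regularCut` (p473407):
the typed existence sentence «We then have an ideal exponent Ě … (43) … where ℘(Ě) is the maximum» (instantiated reading,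
guards as typed by res-type-010; EXISTENCE NOT SHOWN IN PRINT) follows from `HatOrdPowCut IsEdgeData A n`, the binder consumed
at the one step «choose the cut `C`»; witness `cutDown Ê C`. OUR argument; NOT a statement of the manuscript. [folklore] -/
theorem U30_2_R2_inst_of_hatOrdPowCut {p : ℕ} [Fact p.Prime] {K : Type u} [Field K] [CharP K p] [PerfectField K]
    (A : AmbientDatum p K) (n : ℕ) (h : HatOrdPowCut IsEdgeData A n) : U30_2_R2_inst IsEdgeData A n := by
  intro E hE _ hd ed hed _
  exact exists_isCoreFocus_of_ordPowCutOn_ambient A (invInst (baseHike E) ed) (baseHike E) hd (h E ed hE hed)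

/-- `U30_2_R2_inst` from the two halves of the weaker door. [folklore] -/
theorem U30_2_R2_inst_of_ordPow_halves {p : ℕ} [Fact p.Prime] {K : Type u} [Field K] [CharP K p] [PerfectField K]
    (A : AmbientDatum p K) (n : ℕ) (h₁ : HatStratumClosed IsEdgeData A n) (h₂ : HatClosureOrdPow IsEdgeData A n) :
    U30_2_R2_inst IsEdgeData A n :=
  U30_2_R2_inst_of_hatOrdPowCut IsEdgeData A n (hatOrdPowCut_of_halves IsEdgeData A n h₁ h₂)

/-- `U30_2_R2_inst` from GUARDED halves — closedness and `OrdPowAlong Σ̄_max` each assumed only at the `Ê` with `0 < Ê.b`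
(which is `U30_2_R2_inst`'s own guard; the form in which slot W3.1 delivers the closedness half). [folklore] -/
theorem U30_2_R2_inst_of_guarded_ordPow_halves {p : ℕ} [Fact p.Prime] {K : Type u} [Field K] [CharP K p]
    [PerfectField K] (A : AmbientDatum p K) (n : ℕ)
    (h₁ : ∀ (E : IdealExponent A.Z) (ed : EdgeDataOn p n (baseHike E)), E.IsStandard → 0 < (baseHike E).b →
      IsEdgeDataOn IsEdgeData (baseHike E) ed →
        StratumRelClosedOn ((baseHike E).sing ∩ S02Preliminaries.closedPoints A.Z) (invField (baseHike E) ed))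
    (h₂ : ∀ (E : IdealExponent A.Z) (ed : EdgeDataOn p n (baseHike E)), E.IsStandard → 0 < (baseHike E).b →
      IsEdgeDataOn IsEdgeData (baseHike E) ed →
        OrdPowAlong (invmaxClosure ((baseHike E).sing ∩ S02Preliminaries.closedPoints A.Z) (invField (baseHike E) ed))) :
    U30_2_R2_inst IsEdgeData A n := by
  intro E hE _ hd ed hed _
  exact ⟨_, isCoreFocus_cutDown_invmaxClosure_ambient A (invInst (baseHike E) ed) (baseHike E) hd
    (h₁ E ed hE hd hed) (h₂ E ed hE hd hed)⟩

end Hat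

end CampaignW31

open CampaignW31

/-! ## Per-`p` slices at row 005 part b's provenance and the compositions with slot W3.1 -/

/-- **[OURS · L1 W3.1] `CampaignW31HatClosureOrdPowI p` — THE NAMED ORD-POW RESIDUAL, `p`-slice**: `CampaignW31.HatClosureOrdPow`
INSTANTIATED with row 005 part b's Def. 4.9 provenance (`CampaignW31.edgeDataProvenance`): for every perfect `K` of
characteristic `p`, ambient datum `A`, `n`, standard `E` on `A.Z` and certified edge-data family on `Sing(Ê)_cl`, the closure
`Σ̄_max(Ê)` of the `Inv_max`-stratum of `ξ ↦ Inv_ξ(Ê)` satisfies `OrdPowAlong`. Replaces the role of nothing printed; implied by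
`CampaignW31HatClosureRegularI p` (`campaignW31HatClosureOrdPowI_of_hatClosureRegularI`); CANDIDATE premise; NOT a statement of
the manuscript. [folklore] -/
def CampaignW31HatClosureOrdPowI (p : ℕ) [Fact p.Prime] : Prop :=
  ∀ (K : Type u) [Field K] [CharP K p] [PerfectField K] (A : AmbientDatum p K) (n : ℕ),
    HatClosureOrdPow CampaignW31.edgeDataProvenance A n

/-- Pure logic: the regular residual implies the ORD-POW residual, `p`-slices. [folklore] -/
theorem campaignW31HatClosureOrdPowI_of_hatClosureRegularI (p : ℕ) [Fact p.Prime]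
    (h : CampaignW31HatClosureRegularI.{u} p) : CampaignW31HatClosureOrdPowI.{u} p :=
  fun K _ _ _ A n => hatClosureOrdPow_of_hatClosureRegular CampaignW31.edgeDataProvenance A n (h K A n)

/-- Pure logic: `CampaignW31HatStratumClosedI p ∧ CampaignW31HatClosureOrdPowI p → CampaignW31HatOrdPowCutI p`. [folklore] -/
theorem campaignW31HatOrdPowCutI_of_halves (p : ℕ) [Fact p.Prime] (h₁ : CampaignW31HatStratumClosedI.{u} p)
    (h₂ : CampaignW31HatClosureOrdPowI.{u} p) : CampaignW31HatOrdPowCutI.{u} p :=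
  fun K _ _ _ A n => hatOrdPowCut_of_halves CampaignW31.edgeDataProvenance A n (h₁ K A n) (h₂ K A n)

/-- **[OURS · L1 W3.1 → D-lane] existence of `Ě` at the Def. 4.9 provenance FROM the weaker door**, `p`-slice:
`CampaignW31HatOrdPowCutI p → ∀ K A n, U30_2_R2_inst edgeDataProvenance A n`. [folklore] -/
theorem U30_2_R2_inst_of_hatOrdPowCutI (p : ℕ) [Fact p.Prime] (h : CampaignW31HatOrdPowCutI.{u} p)
    (K : Type u) [Field K] [CharP K p] [PerfectField K] (A : AmbientDatum p K) (n : ℕ) :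
    U30_2_R2_inst CampaignW31.edgeDataProvenance A n :=
  U30_2_R2_inst_of_hatOrdPowCut CampaignW31.edgeDataProvenance A n (h K A n)

/-- **[OURS · L1 W3.1 → D-lane] existence of `Ě` (typed `U30_2_R2_inst` at the Def. 4.9 provenance) FROM the W3.1 consequence
statement `CampaignW31InvmaxClosedI p` (Inv_max attained, stratum closed) AND the ORD-POW residual**: per `(E, ed)` with
`0 < b̂`, closedness (`campaignW31HatStratumClosedI_of_invmaxClosedI`, p476257) and `OrdPowAlong Σ̄_max` give the canonical
witness `cutDown Ê Σ̄_max`. The ORD-POW analogue of seat res-L1-s31-pv-2's `CampaignW31.U30_2_R2_inst_of_usc_and_closureRegular`.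
NOT a statement of the manuscript. [folklore] -/
theorem U30_2_R2_inst_of_invmaxClosedI_and_closureOrdPow (p : ℕ) [Fact p.Prime]
    (h₁ : CampaignW31InvmaxClosedI.{u} p) (h₂ : CampaignW31HatClosureOrdPowI.{u} p)
    (K : Type u) [Field K] [CharP K p] [PerfectField K] (A : AmbientDatum p K) (n : ℕ) :
    U30_2_R2_inst CampaignW31.edgeDataProvenance A n :=
  U30_2_R2_inst_of_guarded_ordPow_halves CampaignW31.edgeDataProvenance A n
    (fun E ed hE hb hed => campaignW31HatStratumClosedI_of_invmaxClosedI p h₁ K A n E ed hE hb hed)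
    (fun E ed hE _ hed => h₂ K A n E ed hE hed)

/-- **[OURS · L1 W3.1 → D-lane] existence of `Ě` FROM THE SLOT STATEMENT and the ORD-POW residual**:
`CampaignW31UscInvOneExponentI p → CampaignW31HatClosureOrdPowI p → ∀ K A n, U30_2_R2_inst edgeDataProvenance A n`
(through res-L1-k31's `campaignW31InvmaxClosedI_of_uscInvOneExponentI`, p467881). NOT a statement of the manuscript. [folklore] -/
theorem U30_2_R2_inst_of_usc_and_closureOrdPow (p : ℕ) [Fact p.Prime]
    (h₁ : CampaignW31UscInvOneExponentI.{u} p) (h₂ : CampaignW31HatClosureOrdPowI.{u} p)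
    (K : Type u) [Field K] [CharP K p] [PerfectField K] (A : AmbientDatum p K) (n : ℕ) :
    U30_2_R2_inst CampaignW31.edgeDataProvenance A n :=
  U30_2_R2_inst_of_invmaxClosedI_and_closureOrdPow p (campaignW31InvmaxClosedI_of_uscInvOneExponentI p h₁) h₂ K A n

end Summit.ResolutionOfSingularities.ResolutionOfSingularities.Theorems

end
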